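import Literature.NumberTheory.Transcendental.ZudilinBricksArith
import Literature.NumberTheory.Transcendental.PartialFractions
import HarnessLib

/-!
# The partial-fraction coefficients of `Rₙ(k)` as divided derivatives ([Zudilin2004, Lemma 19])

Topic `Literature/NumberTheory/Transcendental`. For Zudilin's rational function `Rₙ`
(`ZudilinOddZeta.lean`, Fischler's variable) we define the coefficients

  `B n s i = (1/(10-s)!) (d/dk)^{10-s} (Rₙ(k)(k+i)^{10})|_{k=-i}`  (`= divDeriv (10-s) (G n i) (-i)`)

([Zudilin2004, proof of Lemma 19]: `B_{jk} = (1/(q-j)!)(R(t)(t+k)^{q-r})^{(q-j)}|_{t=-k}`, with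
`s = j - r`, `q - r = 10`; [Fischler2004, §3.3]: `c_{i,j,n}`) and prove the partial-fraction
expansion

  `Rₙ(k) = ∑_{i=2n}^{35n} ∑_{s=1}^{10} B n s i · (k+i)^{-s}`   (`Zudilin2004.R_eq_sum_B`)

away from the poles: the EXISTENCE of some expansion with poles of order `≤ 10` at
`-i`, `i ∈ [2n, 35n]`, is `PartialFractions.lean` (degree of the numerator `162n+1 <` number of
linear factors `240n+10`); its coefficients are then IDENTIFIED with the `B n s i` by comparing
germs at `-i` (both `G n i` and the expansion times `(k+i)^{10}` are smooth at `-i` and agree on a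
punctured neighbourhood). Everything here is PROVED (no named facts).

## References

* [Zudilin2004] W. Zudilin, *Arithmetic of linear forms involving odd zeta values*, J. Théor.
  Nombres Bordeaux 16 (2004), 251–291, §8, proof of Lemma 19.
* [Fischler2004] S. Fischler, Sém. Bourbaki exp. 910, Astérisque 294 (2004), §3.3.
-/

noncomputable section

open Finset Filter Topology Polynomial Literature.Analysis.Calculus
open scoped Nat

namespace Literature.NumberTheory.Transcendental

namespace Zudilin2004

/-! ### The coefficients -/

/-- **The partial-fraction coefficients** `B n s i = (1/(10-s)!) (Rₙ(k)(k+i)^{10})^{(10-s)}|_{k=-i}`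
of `Rₙ` at the pole `-i` ([Zudilin2004, proof of Lemma 19]; `c_{i,s,n}` of [Fischler2004, §3.3]).
[cite: Zudilin2004, §8 Lemma 19 (proof)] -/
def B (n s i : ℕ) : ℚ := divDeriv (10 - s) (G n i) (-(i : ℚ))

/-- The set of pole indices `T = [2n, 35n]`. [cite: Fischler2004, §3.3] -/
def poleSet (n : ℕ) : Finset ℕ := Icc (2 * n) (35 * n)

/-! ### `Rₙ` as `P(k) ∏ (k+i)⁻¹` -/

/-- The numerator polynomial of `Rₙ`. [cite: Fischler2004, §3.3] -/
def numPoly (n : ℕ) : ℚ[X] :=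
  C (normConst n : ℚ) * (C 2 * X + C (37 * n : ℚ)) *
    (∏ i ∈ Icc 1 (27 * n), (X - C (i : ℚ))) ^ 3 * (∏ i ∈ Icc (37 * n + 1) (64 * n), (X + C (i : ℚ))) ^ 3

/-- The list of shifts of the linear factors of the denominator of `Rₙ` (with multiplicity).
[cite: Fischler2004, §3.3] -/
def denList (n : ℕ) : List ℕ :=
  (Icc 1 10).toList.flatMap fun u => (Icc ((12 - u) * n) ((25 + u) * n)).toList

/-- `deg numPoly ≤ 162n + 1`. [folklore] -/
theorem natDegree_numPoly_le (n : ℕ) : (numPoly n).natDegree ≤ 162 * n + 1 := by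
  unfold numPoly
  have h1 : (C (normConst n : ℚ) * (C 2 * X + C (37 * n : ℚ))).natDegree ≤ 1 :=
    (natDegree_C_mul_le _ _).trans natDegree_linear_le
  have hA : (∏ i ∈ Icc 1 (27 * n), (X - C (i : ℚ))).natDegree ≤ 27 * n := by
    refine (natDegree_prod_le _ _).trans ?_
    simp only [natDegree_X_sub_C, sum_const, smul_eq_mul, mul_one, Nat.card_Icc]
    omega
  have hB : (∏ i ∈ Icc (37 * n + 1) (64 * n), (X + C (i : ℚ))).natDegree ≤ 27 * n := by
    refine (natDegree_prod_le _ _).trans ?_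
    simp only [natDegree_X_add_C, sum_const, smul_eq_mul, mul_one, Nat.card_Icc]
    omega
  have hA3 := natDegree_pow_le.trans (Nat.mul_le_mul_left 3 hA)
  have hB3 := natDegree_pow_le.trans (Nat.mul_le_mul_left 3 hB)
  refine (natDegree_mul_le.trans (add_le_add (natDegree_mul_le.trans (add_le_add h1 hA3)) hB3)).trans ?_
  omega

/-- `|denList| = 240n + 10`. [folklore] -/
theorem length_denList (n : ℕ) : (denList n).length = 240 * n + 10 := by
  unfold denList
  rw [List.length_flatMap]
  have : ((Icc 1 10).toList.map fun u => ((Icc ((12 - u) * n) ((25 + u) * n)).toList).length)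
      = (Icc 1 10).toList.map fun u => (13 + 2 * u) * n + 1 := by
    refine List.map_congr_left fun u hu => ?_
    rw [Finset.mem_toList, mem_Icc] at hu
    rw [Finset.length_toList, Nat.card_Icc]
    have h2 : (25 + u) * n = (12 - u) * n + (13 + 2 * u) * n := by
      rw [← add_mul]; congr 1; omega
    omega
  rw [this, Finset.sum_map_toList]
  simp [show Icc 1 10 = {1,2,3,4,5,6,7,8,9,10} by rfl]
  ring

/-- Every shift occurs at most `10` times. [folklore] -/
theorem count_denList_le (n i : ℕ) : (denList n).count i ≤ 10 := by
  unfold denList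
  rw [List.count_flatMap]
  have h1 : ∀ x ∈ (Icc 1 10).toList.map
      (List.count i ∘ fun u => (Icc ((12 - u) * n) ((25 + u) * n)).toList), x ≤ 1 := by
    intro x hx
    rw [List.mem_map] at hx
    obtain ⟨u, _, rfl⟩ := hx
    exact List.nodup_iff_count_le_one.1 (Finset.nodup_toList _) i
  refine (List.sum_le_card_nsmul _ 1 h1).trans ?_
  simp [Finset.length_toList]

/-- Every shift lies in `[2n, 35n]`. [folklore] -/
theorem mem_poleSet_of_mem_denList {n i : ℕ} (h : i ∈ denList n) : i ∈ poleSet n := by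
  unfold denList at h
  rw [List.mem_flatMap] at h
  obtain ⟨u, hu, hi⟩ := h
  rw [Finset.mem_toList, mem_Icc] at hu hi
  refine mem_Icc.2 ⟨le_trans (Nat.mul_le_mul_right n (by omega)) hi.1,
    hi.2.trans (Nat.mul_le_mul_right n (by omega))⟩

/-- `Rₙ(k) = numPoly(k) · ∏_{i ∈ denList} (k+i)⁻¹`. [cite: Fischler2004, §3.3] -/
theorem R_eq_eval_mul_prod (n : ℕ) (k : ℚ) :
    R n k = (numPoly n).eval k * ((denList n).map fun i : ℕ => (k + (i : ℚ))⁻¹).prod := by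
  have hprod : ((denList n).map fun i : ℕ => (k + (i : ℚ))⁻¹).prod
      = ∏ u ∈ Icc 1 10, ∏ i ∈ Icc ((12 - u) * n) ((25 + u) * n), (k + (i : ℚ))⁻¹ := by
    unfold denList
    rw [List.map_flatMap, List.flatMap_def, List.prod_flatten, List.map_map,
      ← Finset.prod_map_toList]
    refine congrArg List.prod (List.map_congr_left fun u _ => ?_)
    simp [Finset.prod_map_toList]
  rw [hprod, R, numPoly]
  simp only [eval_mul, eval_C, eval_add, eval_X, eval_pow, eval_prod, eval_sub, Rat.cast_id]
  rw [div_eq_mul_inv]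
  congr 1
  · ring
  · rw [← prod_inv_distrib]
    exact prod_congr rfl fun u _ => (prod_inv_distrib _).symm

/-! ### Existence of an expansion with poles of order `≤ 10` -/

/-- There are constants `c i s` with `Rₙ(k) = ∑_{i∈T} ∑_{s=1}^{10} c i s (k+i)^{-s}` away from the
poles. [cite: Zudilin2004, §8 Lemma 19 (proof)] -/
theorem exists_R_eq_pfEval (n : ℕ) : ∃ c : ℕ → ℕ → ℚ, ∀ k : ℚ, (∀ i ∈ poleSet n, k + i ≠ 0) →
    R n k = pfEval (poleSet n) (fun _ => 10) c k := by
  have hL : ∀ i ∈ denList n, i ∈ poleSet n := fun i hi => mem_poleSet_of_mem_denList hi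
  have hdeg : (numPoly n).natDegree < (denList n).length := by
    rw [length_denList]; have := natDegree_numPoly_le n; omega
  obtain ⟨c, hc⟩ := exists_pfEval_eq_eval_mul_prod_inv (poleSet n) (numPoly n) (denList n) hL hdeg
  have hPF : IsPF (poleSet n) (fun i => (denList n).count i) (R n) :=
    ⟨c, fun k hk => (R_eq_eval_mul_prod n k).trans (hc k hk)⟩
  obtain ⟨c', hc'⟩ := hPF.mono fun i _ => count_denList_le n i
  exact ⟨c', hc'⟩

/-! ### Identification of the coefficients -/

/-- A punctured neighbourhood of `-i₀` contains no pole of `Rₙ` and not `-i₀`. [folklore] -/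
theorem eventually_good (n i₀ : ℕ) :
    ∀ᶠ k : ℚ in 𝓝[≠] (-(i₀ : ℚ)), k + i₀ ≠ 0 ∧ ∀ i ∈ poleSet n, k + i ≠ 0 := by
  filter_upwards [eventually_ne_poles (2 * n : ℤ) (33 * n + 1) (i₀ : ℤ)] with k hk
  refine ⟨by exact_mod_cast hk.1, fun i hi => ?_⟩
  have hi' := mem_Icc.1 hi
  have h := hk.2 (i - 2 * n) (mem_range.2 (by omega))
  have e : (((2 * n : ℤ) + ((i - 2 * n : ℕ) : ℤ) : ℤ) : ℚ) = (i : ℚ) := by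
    rw [Nat.cast_sub hi'.1]; push_cast; ring
  rwa [e] at h

/-- `G n i₀` is continuous at `-i₀` (`i₀ ∈ T`). [folklore] -/
theorem continuousAt_G (n : ℕ) {i₀ : ℕ} (hi₀ : i₀ ∈ poleSet n) :
    ContinuousAt (G n i₀) (-(i₀ : ℚ)) :=
  (G_isDInt n hi₀ 0).contDiffAt.continuousAt

/-- Smoothness of `(k+i)^{-s}` at `-i₀`, `i ≠ i₀`. [folklore] -/
theorem contDiffAt_inv_pow {i i₀ : ℕ} (h : i ≠ i₀) (s : ℕ) {N : WithTop ℕ∞} :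
    ContDiffAt ℚ N (fun k : ℚ => ((k + i) ^ s)⁻¹) (-(i₀ : ℚ)) := by
  refine ((contDiffAt_id.add contDiffAt_const).pow s).inv ?_
  simp only [id]
  refine pow_ne_zero _ ?_
  rw [show (-(i₀ : ℚ) + i) = ((i - i₀ : ℤ) : ℚ) by push_cast; ring]
  exact_mod_cast sub_ne_zero.2 (by exact_mod_cast h : (i : ℤ) ≠ i₀)

/-- **Identification of the coefficients**: if `Rₙ = pfEval T 10 c` away from the poles, then for
`i₀ ∈ T` and `a ≤ 9`, `(1/a!) (G n i₀)^{(a)}(-i₀) = c i₀ (10 - a)`; i.e. the coefficient of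
`(k+i₀)^{-s}` is `B n s i₀`. [cite: Zudilin2004, §8 Lemma 19 (proof)] -/
theorem divDeriv_G_eq_coeff (n : ℕ) {c : ℕ → ℕ → ℚ}
    (hc : ∀ k : ℚ, (∀ i ∈ poleSet n, k + i ≠ 0) → R n k = pfEval (poleSet n) (fun _ => 10) c k)
    {i₀ : ℕ} (hi₀ : i₀ ∈ poleSet n) {a : ℕ} (ha : a ≤ 9) :
    divDeriv a (G n i₀) (-(i₀ : ℚ)) = c i₀ (10 - a) := by
  -- the regular part `H` and the candidate germ `F`
  set H : ℚ → ℚ := fun k => ∑ i ∈ (poleSet n).erase i₀, ∑ s ∈ Icc 1 10, c i s * ((k + i) ^ s)⁻¹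
    with hH
  set F : ℚ → ℚ := fun k => ∑ s ∈ Icc 1 10, c i₀ s * (k - (-(i₀ : ℚ))) ^ (10 - s)
    + (k - (-(i₀ : ℚ))) ^ 10 * H k with hF
  have hHs : ContDiffAt ℚ (⊤ : ℕ∞) H (-(i₀ : ℚ)) := by
    refine ContDiffAt.sum fun i hi => ContDiffAt.sum fun s _ => ?_
    exact contDiffAt_const.mul (contDiffAt_inv_pow (ne_of_mem_erase hi) s)
  have hterm : ∀ s ∈ Icc 1 10, ContDiffAt ℚ (⊤ : ℕ∞)
      (fun k : ℚ => c i₀ s * (k - (-(i₀ : ℚ))) ^ (10 - s)) (-(i₀ : ℚ)) := fun s _ =>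
    contDiffAt_const.mul (contDiffAt_sub_pow _ _ _)
  have hFs : ContDiffAt ℚ (⊤ : ℕ∞) F (-(i₀ : ℚ)) :=
    (ContDiffAt.sum fun s hs => hterm s hs).add ((contDiffAt_sub_pow _ _ _).mul hHs)
  -- `G = F` near `-i₀`
  have hGF : G n i₀ =ᶠ[𝓝 (-(i₀ : ℚ))] F := by
    refine eventuallyEq_of_nhdsNE (continuousAt_G n hi₀) hFs.continuousAt ?_
    filter_upwards [eventually_good n i₀] with k hk
    rw [G_eq n i₀ hk.1, hc k hk.2, pfEval, ← add_sum_erase _ _ hi₀, hF, hH]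
    simp only [sub_neg_eq_add]
    rw [add_mul, sum_mul, mul_comm _ (H k)]
    congr 1
    refine sum_congr rfl fun s hs => ?_
    have hs' := (mem_Icc.1 hs).2
    rw [mul_assoc]
    congr 1
    have hpow : (k + i₀) ^ 10 = (k + i₀) ^ s * (k + i₀) ^ (10 - s) := by
      rw [← pow_add]; congr 1; omega
    rw [hpow, ← mul_assoc, inv_mul_cancel₀ (pow_ne_zero s hk.1), one_mul]
  -- compute the divided derivative of `F`
  rw [divDeriv_congr hGF, hF]
  have ha' : ContDiffAt ℚ a (fun k => (k - (-(i₀ : ℚ))) ^ 10 * H k) (-(i₀ : ℚ)) :=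
    ((contDiffAt_sub_pow _ _ _).mul hHs).of_le (mod_cast le_top)
  rw [divDeriv_fun_add ((ContDiffAt.sum fun s hs => hterm s hs).of_le (mod_cast le_top)) ha',
    divDeriv_sub_pow_mul (hHs.of_le (mod_cast le_top)) 10, if_pos (by omega), add_zero,
    divDeriv_sum fun s hs => (hterm s hs).of_le (mod_cast le_top)]
  simp_rw [divDeriv_const_mul, divDeriv_sub_pow]
  rw [sum_eq_single_of_mem (10 - a) (mem_Icc.2 ⟨by omega, by omega⟩)]
  · rw [if_pos (by omega), mul_one]
  · intro s hs hsa
    rw [if_neg (by have := mem_Icc.1 hs; omega), mul_zero]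

/-- **Partial fractions of `Rₙ` with the coefficients `B`** ([Zudilin2004, proof of Lemma 19]:
`R(t) = ∑_{j=r+1}^{q} ∑_k B_{jk}/(t+k)^{j-r}`): away from the poles,
`Rₙ(k) = ∑_{i=2n}^{35n} ∑_{s=1}^{10} B n s i · ((k+i)^s)⁻¹`. [cite: Zudilin2004, §8 Lemma 19 (proof)] -/
theorem R_eq_sum_B (n : ℕ) (k : ℚ) (hk : ∀ i ∈ poleSet n, k + i ≠ 0) :
    R n k = ∑ i ∈ poleSet n, ∑ s ∈ Icc 1 10, B n s i * ((k + i) ^ s)⁻¹ := by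
  obtain ⟨c, hc⟩ := exists_R_eq_pfEval n
  rw [hc k hk, pfEval]
  refine sum_congr rfl fun i hi => sum_congr rfl fun s hs => ?_
  have hs' := mem_Icc.1 hs
  rw [B, divDeriv_G_eq_coeff n hc hi (by omega), show 10 - (10 - s) = s by omega]

/-- `B n s i = 0` for `s > poleOrderBound n i`, in particular for `i > (36-s)n`. [cite: Fischler2004, §3.3] -/
theorem B_eq_zero_of_lt (n : ℕ) {i s : ℕ} (hs : 1 ≤ s) (hs' : s ≤ 10) (h : (36 - s) * n < i) :
    B n s i = 0 := by
  have := poleOrderBound_lt_of_lt hs hs' h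
  exact divDeriv_G_eq_zero n i (by omega)

end Zudilin2004

end Literature.NumberTheory.Transcendental
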